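import Summits.Ventures.GridStability.Models.InverterInstances
import Summits.Ventures.GridStability.Bench.GFMSMIBDeg4AQoriaV4physRoa

/-!
# GridStability/Models/InverterDroopGFMSMIBDeg4Roa — rung G3.a «+» row (degree 4): the certified ROA of «GFM-SMIB-QoriaV4», read on the droop grid-forming converter model (hypothesis-free transport)

Degree-4 twin of `Models/InverterDroopGFMSMIBRoa.lean` (p471944, degree 2, level `55`). Companion of
lyap-1's `Bench/GFMSMIBDeg4AQoriaV4physRoa.lean` (decls `Bench.GFMSMIB.deg4_A_QoriaV4phys_{V, level,
smib_roa}` — certificate level `21/4`, degree-4 `V` — consumed verbatim; that file says the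
converter-side reading «is not repeated here»: this file supplies it) and of sos-5's Bench files
`GFMSMIBDeg4AQoriaV4phys{Data,}.lean` (p470051 / p470060; cert `cert/A/GFM-SMIB-deg4-A-QoriaV4phys.json`
`be1bb781f69ae869…`); seat gridfusion-model-3 (g4).

Cell `gridfusion` (LADDER-GRIDFUSION, APEX LINE rung G3.a, director RULING 16 (a) + RULING 12 (higher
degree = the «+» improvement row); lead PARTITION A19 third addendum: instance of record =
PHYSICAL-time reading = `InverterDroop.gfmSmibQoriaV4` (p469363)). THREE COLUMNS. CERTIFIED (kernel,
Bench file, unchanged): the four deg-4 toolchain-A identities of instance GFM-SMIB-QoriaV4 (physical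
time): `V ≥ φ/100` on `{h = 0}`; `V̇ ≤ −φ/2000`, `φ ≤ 3`, `κ ≤ 1` on `{h = 0} ∩ {V ≤ 21/4}`.
MODELLED: the conclusion is about the reduced droop-GFM converter model «GFM-SMIB-QoriaV4» =
`InverterDroop.gfmSmibQoriaV4` ([cite: Qoria2020, (III-46)+(V-13), §V.4]; MODEL-VALIDITY MV-6D + MV-P
+ MV-Ω(ω_b′ = 35500/113); current limitation, TVR/virtual impedance, inner loops, line dynamics
ABSENT). VALIDATED: nothing. The two certified regions (deg 2, level 55, p471944; deg 4, level 21/4,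
this file) are both INNER estimates for the same model and equilibrium; their UNION is certified.
No sentence here says a converter or a grid is stable.

As in p471944, this theorem has NO data hypotheses: the four A1 relations are the kernel facts
`gfmSmibQoriaV4.rel_a/rel_b/rel_d/power_balance` of `InverterInstances.lean` (p469363).
-/

noncomputable section

open Real Set Filter Topology
open Summit.Ventures.GridStability.Bench.GFMSMIB

namespace Summit.Ventures.GridStability.Models.InverterDroop.gfmSmibQoriaV4

/-- **Rung G3.a, -roa sentence for the converter model (hypothesis-free).** For every
`0 < γ ≤ level = 21/4` of the certified deg-4 certificate of «GFM-SMIB-QoriaV4» and every solution `(δ, ω)`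
of the droop-GFM model of record `InverterDroop.gfmSmibQoriaV4` (derivatives at all times) whose
initial recast state has `V(sin u₀, 1 − cos u₀, ω_b′(ω₀ − ω_e)) ≤ γ` and `|u₀| < π`
(`u = δ − δ^s`, `δ^s = arcsin(2072640/16581121)`): for all `t ≥ 0`, `V ≤ γ` along the recast state
and `|δ t − δ^s| < π` (the converter angle never pole-slips), and `(δ t, ω_b′(ω t − ω_e)) → (δ^s, 0)`.
Transport of lyap-1's `deg4_A_QoriaV4phys_smib_roa` along `toGridSMIB` (p462458) with the
instance's kernel-checked data relations (p469363). MODELLED: MV-6D + MV-P + MV-Ω. [folklore] -/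
theorem deg4_A_roa {γ : ℝ} (hγ0 : 0 < γ) (hγ : γ ≤ deg4_A_QoriaV4phys_level)
    {δ ω : ℝ → ℝ} (h : gfmSmibQoriaV4.IsSolution δ ω)
    (h0V : deg4_A_QoriaV4phys_V (sin (δ 0 - gfmSmibQoriaV4_δs)) (1 - cos (δ 0 - gfmSmibQoriaV4_δs))
      (gfmSmibQoriaV4.ωb * (ω 0 - gfmSmibQoriaV4.ωe)) ≤ γ)
    (h0win : |δ 0 - gfmSmibQoriaV4_δs| < π) :
    (∀ t, 0 ≤ t →
        deg4_A_QoriaV4phys_V (sin (δ t - gfmSmibQoriaV4_δs)) (1 - cos (δ t - gfmSmibQoriaV4_δs))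
            (gfmSmibQoriaV4.ωb * (ω t - gfmSmibQoriaV4.ωe)) ≤ γ ∧
          |δ t - gfmSmibQoriaV4_δs| < π) ∧
      Tendsto (fun t => (δ t, gfmSmibQoriaV4.ωb * (ω t - gfmSmibQoriaV4.ωe))) atTop
        (𝓝 (gfmSmibQoriaV4_δs, 0)) := by
  have hM := gfmSmibQoriaV4.toGridSMIB_M_ne_zero ki_ne_zero ωc_ne_zero
  have ha' : ((233605208200 / 1873666673 : ℚ) : ℝ)
      = gfmSmibQoriaV4.toGridSMIB.PM * cos (gfmSmibQoriaV4_δs - gfmSmibQoriaV4.toGridSMIB.γ)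
        / gfmSmibQoriaV4.toGridSMIB.M := by rw [gfmSmibQoriaV4.toGridSMIB_a, rel_a]
  have hb' : ((29431488000 / 1873666673 : ℚ) : ℝ)
      = gfmSmibQoriaV4.toGridSMIB.PM * sin (gfmSmibQoriaV4_δs - gfmSmibQoriaV4.toGridSMIB.γ)
        / gfmSmibQoriaV4.toGridSMIB.M := by rw [gfmSmibQoriaV4.toGridSMIB_b, rel_b]
  have hd' : ((33 : ℚ) : ℝ) = gfmSmibQoriaV4.toGridSMIB.D / gfmSmibQoriaV4.toGridSMIB.M := by
    rw [gfmSmibQoriaV4.toGridSMIB_d ki_ne_zero, rel_d]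
  have hP' : gfmSmibQoriaV4.toGridSMIB.IsEquilibrium gfmSmibQoriaV4_δs :=
    (gfmSmibQoriaV4.isEquilibrium_toGridSMIB_iff _).2 power_balance
  have hx : gfmSmibQoriaV4.toGridSMIB.IsSolutionOn
      (fun t => gfmSmibQoriaV4.toGridState (δ t, ω t)) (Ici 0) :=
    gfmSmibQoriaV4.isSolutionOn_toGridSMIB ωb_ne_zero ki_ne_zero ωc_ne_zero ωset_eq h (Ici 0)
  have hres := deg4_A_QoriaV4phys_smib_roa gfmSmibQoriaV4.toGridSMIB hM ha' hb' hd' hP' hγ0 hγ hx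
    (by simpa [ReducedParams.toGridState] using h0V) (by simpa [ReducedParams.toGridState] using h0win)
  simpa [ReducedParams.toGridState] using hres

/-- Corollary in the converter's per-unit frequency (degree-4 region): `δ t → δ^s` and `ω t → ω_e` (= 1 p.u.).
MODELLED: MV-6D + MV-P + MV-Ω. [folklore] -/
theorem deg4_A_freq_tendsto {γ : ℝ} (hγ0 : 0 < γ) (hγ : γ ≤ deg4_A_QoriaV4phys_level)
    {δ ω : ℝ → ℝ} (h : gfmSmibQoriaV4.IsSolution δ ω)
    (h0V : deg4_A_QoriaV4phys_V (sin (δ 0 - gfmSmibQoriaV4_δs)) (1 - cos (δ 0 - gfmSmibQoriaV4_δs))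
      (gfmSmibQoriaV4.ωb * (ω 0 - gfmSmibQoriaV4.ωe)) ≤ γ)
    (h0win : |δ 0 - gfmSmibQoriaV4_δs| < π) :
    Tendsto δ atTop (𝓝 gfmSmibQoriaV4_δs) ∧ Tendsto ω atTop (𝓝 gfmSmibQoriaV4.ωe) := by
  obtain ⟨-, hlim⟩ := deg4_A_roa hγ0 hγ h h0V h0win
  have hδ : Tendsto δ atTop (𝓝 gfmSmibQoriaV4_δs) := by simpa using hlim.fst_nhds
  have hΩ : Tendsto (fun t => gfmSmibQoriaV4.ωb * (ω t - gfmSmibQoriaV4.ωe)) atTop (𝓝 0) := by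
    simpa using hlim.snd_nhds
  refine ⟨hδ, ?_⟩
  have hb := ωb_ne_zero
  have hω' : Tendsto (fun t => gfmSmibQoriaV4.ωb⁻¹ * (gfmSmibQoriaV4.ωb * (ω t - gfmSmibQoriaV4.ωe))
      + gfmSmibQoriaV4.ωe) atTop (𝓝 (gfmSmibQoriaV4.ωb⁻¹ * 0 + gfmSmibQoriaV4.ωe)) :=
    (hΩ.const_mul _).add_const _
  have heq : (fun t => gfmSmibQoriaV4.ωb⁻¹ * (gfmSmibQoriaV4.ωb * (ω t - gfmSmibQoriaV4.ωe))
      + gfmSmibQoriaV4.ωe) = ω := by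
    funext t; field_simp; ring
  rw [heq] at hω'
  simpa using hω'

end Summit.Ventures.GridStability.Models.InverterDroop.gfmSmibQoriaV4

end
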